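import Mathlib
import Literature.NumberTheory.LFunctions.Zhang2022.TypedSection15C
import Literature.NumberTheory.LFunctions.Zhang2022.Section15BCoprimeLocalEstimate
import Literature.NumberTheory.LFunctions.Zhang2022.Section15BLocalEstimates
import Literature.NumberTheory.LFunctions.Zhang2022.AppendixALemma152Closed
import HarnessLib

/-!
# Zhang (2022), §15 p. 85: (15.18) at `s = 1 − βⱼ` and "`ϖ₁ⱼ` is multiplicative" — kernel-checked

Topic `Literature/NumberTheory/LFunctions/Zhang2022` (Landau–Siegel audit tree; verdict-neutral).
Y. Zhang, *Discrete mean estimates and the Landau–Siegel zero*, arXiv:2211.02515v1 (2022)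
[Zhang2022LandauSiegel] — **an unrefereed manuscript under adjudication; nothing in this file asserts
or denies its Theorems 1–2.** ZHANG-L discharge lane (WP15), first file of the chain towards the leaf
`Typed.Section15C.Lemma153RpI` (Lemma 15.3, analytic part, repaired normaliser; rows G-L4t3-1 /
G-d52-1): the GLOBAL structure of `ϖ₁ⱼ` (§15 p. 85, tex L4235–L4246).

What is PROVED here (theorems only; no new definitions, no facts):

* `calM1Factor_ne_zero_of_calM1_ne_zero` — a convergent Euler product with a vanishing factor
  vanishes; so `𝓜₁(1,1;s) ≠ 0` forces every local factor `≠ 0`.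
* `calM1_eq_calM1_mul_prod` — **(15.18) at a point**: if the Euler product of `𝓜₁(1,1;s)` converges
  to a non-zero value, then for all `d, l ≥ 1`
  `𝓜₁(d,l;s) = 𝓜₁(1,1;s) · ∏_{q∣dl} ρ_q(d,l;s)`, `ρ_q = (1 + λ̃₁(q,d)Σ_r ξ₁(qʳ;d,l)q^{−rs})
  (1 + λ̃₁(q,1)Σ_r ξ₁(qʳ;1,1)q^{−rs})⁻¹` (the factors at `q ∤ dl` coincide, `inline15_localEq_holds`).
* `half_le_norm_calM1_one_one` — for all large `D` under (A) and `1 ≤ j ≤ 3`: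
  `‖𝓜₁(1,1;1−βⱼ)‖ ≥ 1/2` (Lemma 15.2, `AppendixALocal.lemma152I_holds`, `|βⱼ| < 5α`, and the Euler
  product `∏_{(q,D)=1}(1−χ(q)q⁻²)/(1−q⁻²)` has modulus `≥ 1`).
* `eq15_18_at_betaJ` — (15.18) at `s = 1 − βⱼ` for all large `D` under (A), in the shape of
  `Typed.Section15B.Eq15_18` (which quantifies over all `σ > 9/10` and is not used).
* `inline15_varpiMult_holds` — **the inline claim of p. 85 "`ϖ₁ⱼ(n)` is a multiplicative function"
  (`Typed.Section15B.Inline15_varpiMult c′`) HOLDS**, for every `c′` (the tree's edge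
  `inline15_varpiMult_of_eq15_18` re-run on the pointwise (15.18)).

## References

* Y. Zhang, arXiv:2211.02515v1 (2022), §15 p. 85 (15.18)–(15.19); Lemma 15.2 p. 87.
  [cite: Zhang2022LandauSiegel, §15 p. 85]
-/

noncomputable section

open Complex Real Filter Topology

namespace Literature.NumberTheory.LFunctions.Zhang2022.Lemma153Rp

open Literature.NumberTheory.LFunctions.Zhang2022
open Literature.NumberTheory.LFunctions.Zhang2022.Typed.Section15A
open Literature.NumberTheory.LFunctions.Zhang2022.Typed.Section15B

/-! ## §1. Convergent products with a vanishing factor -/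

/-- If one factor of a convergent product in `ℂ` vanishes, the product is `0`. [folklore] -/
private theorem eq_zero_of_hasProd_of_eq_zero {ι : Type*} {f : ι → ℂ} {a : ℂ} (hf : HasProd f a) {i : ι}
    (hi : f i = 0) : a = 0 := by
  classical
  have hT : Tendsto (fun s : Finset ι => ∏ b ∈ s, f b) atTop (𝓝 a) := hf
  have h1 : ∀ᶠ s : Finset ι in atTop, (0 : ℂ) = ∏ b ∈ s, f b := by
    filter_upwards [eventually_ge_atTop {i}] with s hs
    exact (Finset.prod_eq_zero (hs (Finset.mem_singleton_self i)) hi).symm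
  have h0 : Tendsto (fun _ : Finset ι => (0 : ℂ)) atTop (𝓝 (0 : ℂ)) := tendsto_const_nhds
  exact tendsto_nhds_unique hT (h0.congr' h1)

/-- A factor of a convergent product with non-zero value is non-zero (cf. the tree's
`Literature.NumberTheory.Automorphic.ne_zero_of_hasProd_ne_zero`, not imported to keep the §15 cone
small). [folklore] -/
private theorem ne_zero_of_hasProd_ne_zero' {ι : Type*} {f : ι → ℂ} {a : ℂ} (hf : HasProd f a)
    (ha : a ≠ 0) (i : ι) : f i ≠ 0 :=
  fun hi => ha (eq_zero_of_hasProd_of_eq_zero hf hi)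

/-! ## §2. Locality of the Euler factors of `𝓜₁(d,l;s)` -/

variable (c' : ℝ) {D : ℕ} (χ : DirichletCharacter ℂ D)

/-- If the Euler product `∏_q calM1Factor(q,d,l,s)` converges and `𝓜₁(d,l;s) ≠ 0`, then every local
factor is non-zero (elementary step used implicitly at (15.18), where the local factors of
`𝓜₁(1,1;s)` are divided by). [cite: Zhang2022LandauSiegel, §15 (15.18) p. 85] -/
theorem calM1Factor_ne_zero_of_calM1_ne_zero {d l : ℕ} {s : ℂ}
    (hmul : Multipliable fun p : Nat.Primes => calM1Factor c' χ (p : ℕ) d l s)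
    (hne : calM1 c' χ d l s ≠ 0) (p : Nat.Primes) : calM1Factor c' χ (p : ℕ) d l s ≠ 0 :=
  ne_zero_of_hasProd_ne_zero' hmul.hasProd hne p

/-- For a prime `q ∤ dl` the Euler factor of `𝓜₁(d,l;s)` at `q` is that of `𝓜₁(1,1;s)`
(`inline15_localEq_holds`: `λ̃₁(q,d) = λ̃₁(q,1)`, `ξ₁(qʳ;d,l) = ξ₁(qʳ;1,1)`).
[cite: Zhang2022LandauSiegel, §15 p. 85] -/
theorem calM1Factor_eq_of_coprime {q d l : ℕ} (hq : q.Prime) (hd : 1 ≤ d) (hl : 1 ≤ l)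
    (hcop : Nat.Coprime q (d * l)) (s : ℂ) :
    calM1Factor c' χ q d l s = calM1Factor c' χ q 1 1 s := by
  have hloc := inline15_localEq_holds c' D χ q d l
  have hlam : lamTilde1 c' χ q d = lamTilde1 c' χ q 1 := (hloc 1 hq hd hl le_rfl hcop).1
  have hxi : xi1LocalSeries c' χ q d l s = xi1LocalSeries c' χ q 1 1 s := by
    unfold xi1LocalSeries
    refine tsum_congr fun r => ?_
    rcases Nat.eq_zero_or_pos r with rfl | hr
    · simp
    · rw [if_neg hr.ne', if_neg hr.ne', (hloc r hq hd hl hr hcop).2]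
  unfold calM1Factor
  rw [hlam, hxi]

/-- The zeta-quotient prefactor `(1−q^{−s−β₁})(1−q^{−s−β₂})/((1−q^{−s})(1−χ(q)q^{−s}))` of the Euler
factor at a prime `q` is non-zero for `Re s > 0`. [cite: Zhang2022LandauSiegel, §15 p. 84] -/
theorem zetaPrefactor_ne_zero {q : ℕ} (hq : q.Prime) {s : ℂ} (hs : 0 < s.re) :
    (1 - (q : ℂ) ^ (-(s + Skeleton.beta1 c' D))) * (1 - (q : ℂ) ^ (-(s + Skeleton.beta2 c' D))) /
      ((1 - (q : ℂ) ^ (-s)) * (1 - χ (q : ZMod D) * (q : ℂ) ^ (-s))) ≠ 0 := by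
  have hlt : ∀ w : ℂ, w.re = s.re → ‖(q : ℂ) ^ (-w)‖ < 1 := by
    intro w hw
    rw [Complex.norm_natCast_cpow_of_pos hq.pos, Complex.neg_re, hw]
    exact Real.rpow_lt_one_of_one_lt_of_neg (by exact_mod_cast hq.one_lt) (by linarith)
  have hne : ∀ (v w : ℂ), ‖v‖ ≤ 1 → w.re = s.re → 1 - v * (q : ℂ) ^ (-w) ≠ 0 := by
    intro v w hv hw h
    have h1 : v * (q : ℂ) ^ (-w) = 1 := by linear_combination -h
    have h2 : ‖v * (q : ℂ) ^ (-w)‖ < 1 := by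
      rw [norm_mul]
      calc ‖v‖ * ‖(q : ℂ) ^ (-w)‖ ≤ 1 * ‖(q : ℂ) ^ (-w)‖ := by gcongr
        _ < 1 := by rw [one_mul]; exact hlt w hw
    rw [h1, norm_one] at h2
    exact lt_irrefl _ h2
  have hb1 : (s + Skeleton.beta1 c' D).re = s.re := by
    rw [Complex.add_re, beta1_eq_b1_mul_I]; simp
  have hb2 : (s + Skeleton.beta2 c' D).re = s.re := by
    rw [Complex.add_re, beta2_eq_b2_mul_I]; simp
  refine div_ne_zero (mul_ne_zero ?_ ?_) (mul_ne_zero ?_ ?_)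
  · simpa using hne 1 _ (by simp) hb1
  · simpa using hne 1 _ (by simp) hb2
  · simpa using hne 1 _ (by simp) rfl
  · exact hne _ _ (χ.norm_le_one _) rfl

/-- The ratio of the Euler factors of `𝓜₁(d,l;s)` and `𝓜₁(1,1;s)` at `q` is the local factor
`ρ_q(d,l;s)` of (15.18) (the zeta-quotient prefactor cancels; `Re s > 0`).
[cite: Zhang2022LandauSiegel, §15 (15.18) p. 85] -/
theorem calM1Factor_div_eq_localRatio {q : ℕ} (hq : q.Prime) (d l : ℕ) {s : ℂ} (hs : 0 < s.re) :
    calM1Factor c' χ q d l s / calM1Factor c' χ q 1 1 s =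
      (1 + lamTilde1 c' χ q d * xi1LocalSeries c' χ q d l s) *
        (1 + lamTilde1 c' χ q 1 * xi1LocalSeries c' χ q 1 1 s)⁻¹ := by
  have hZ := zetaPrefactor_ne_zero c' χ hq hs
  unfold calM1Factor
  rw [mul_div_mul_left _ _ hZ, div_eq_mul_inv]

/-! ## §3. (15.18) at a point where the Euler product of `𝓜₁(1,1;s)` converges to a non-zero value -/

/-- **(15.18) at a point.** If `∏_q calM1Factor(q,1,1,s)` converges and `𝓜₁(1,1;s) ≠ 0`
(`Re s > 0`), then for all `d, l ≥ 1`: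
`𝓜₁(d,l;s) = 𝓜₁(1,1;s) · ∏_{q∣dl} ρ_q(d,l;s)`. Proof: write the factors of `𝓜₁(d,l;s)` as
`G_q · (F_q/G_q)` with `G_q` the factors of `𝓜₁(1,1;s)` (all non-zero); `F_q/G_q = 1` off the prime
factors of `dl` (`calM1Factor_eq_of_coprime`), so the second product is a finite one.
[cite: Zhang2022LandauSiegel, §15 (15.18) p. 85] -/
theorem calM1_eq_calM1_mul_prod {s : ℂ} (hs : 0 < s.re)
    (hmul : Multipliable fun p : Nat.Primes => calM1Factor c' χ (p : ℕ) 1 1 s)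
    (hne : calM1 c' χ 1 1 s ≠ 0) {d l : ℕ} (hd : 1 ≤ d) (hl : 1 ≤ l) :
    calM1 c' χ d l s = calM1 c' χ 1 1 s *
      ∏ q ∈ (d * l).primeFactors,
        (1 + lamTilde1 c' χ q d * xi1LocalSeries c' χ q d l s) *
          (1 + lamTilde1 c' χ q 1 * xi1LocalSeries c' χ q 1 1 s)⁻¹ := by
  classical
  set G : Nat.Primes → ℂ := fun p => calM1Factor c' χ (p : ℕ) 1 1 s with hG
  set F : Nat.Primes → ℂ := fun p => calM1Factor c' χ (p : ℕ) d l s with hF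
  have hGP : HasProd G (calM1 c' χ 1 1 s) := hmul.hasProd
  have hG0 : ∀ p, G p ≠ 0 := calM1Factor_ne_zero_of_calM1_ne_zero c' χ hmul hne
  -- the ratio `F/G` is `1` off the prime factors of `dl` (as a finset of `Nat.Primes`)
  set emb : {q // q ∈ (d * l).primeFactors} → Nat.Primes :=
    fun q => ⟨q.1, Nat.prime_of_mem_primeFactors q.2⟩ with hemb
  have hemb_inj : Function.Injective emb := by
    intro a b h
    exact Subtype.ext (by simpa [hemb] using congrArg Subtype.val h)
  set S : Finset Nat.Primes := (d * l).primeFactors.attach.image emb with hS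
  have hmemS : ∀ p : Nat.Primes, p ∈ S ↔ (p : ℕ) ∈ (d * l).primeFactors := by
    intro p
    constructor
    · intro hp
      obtain ⟨q, -, hq⟩ := Finset.mem_image.mp hp
      rw [← hq]; exact q.2
    · intro hp
      exact Finset.mem_image.mpr ⟨⟨p, hp⟩, Finset.mem_attach _ _, Subtype.ext rfl⟩
  set ρ : Nat.Primes → ℂ := fun p => F p / G p with hρ
  have hρ1 : ∀ p ∉ S, ρ p = 1 := by
    intro p hp
    have hpdl : ¬ (p : ℕ) ∣ d * l := by
      intro h
      exact hp ((hmemS p).mpr (Nat.mem_primeFactors.mpr ⟨p.prop, h, (Nat.mul_pos hd hl).ne'⟩))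
    have hcop : Nat.Coprime (p : ℕ) (d * l) := (Nat.Prime.coprime_iff_not_dvd p.prop).mpr hpdl
    simp only [hρ, hF, hG, calM1Factor_eq_of_coprime c' χ p.prop hd hl hcop s]
    exact div_self (hG0 p)
  have hρP : HasProd ρ (∏ p ∈ S, ρ p) := hasProd_prod_of_ne_finset_one hρ1
  have hFG : F = fun p => G p * ρ p := by
    funext p; simp only [hρ]; rw [mul_div_cancel₀ _ (hG0 p)]
  have hFP : HasProd F (calM1 c' χ 1 1 s * ∏ p ∈ S, ρ p) := by
    rw [hFG]; exact hGP.mul hρP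
  have hcalM : calM1 c' χ d l s = ∏' p : Nat.Primes, F p := rfl
  rw [hcalM, hFP.tprod_eq]
  congr 1
  -- rewrite the finite product over `S ⊆ Nat.Primes` as a product over `(dl).primeFactors`
  set g : ℕ → ℂ := fun q => (1 + lamTilde1 c' χ q d * xi1LocalSeries c' χ q d l s) *
    (1 + lamTilde1 c' χ q 1 * xi1LocalSeries c' χ q 1 1 s)⁻¹ with hg
  change ∏ p ∈ S, ρ p = ∏ q ∈ (d * l).primeFactors, g q
  rw [← Finset.prod_attach (d * l).primeFactors g, hS,
    Finset.prod_image fun a _ b _ h => hemb_inj h]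
  refine Finset.prod_congr rfl fun q _ => ?_
  simp only [hρ, hF, hG, hg, hemb]
  exact calM1Factor_div_eq_localRatio c' χ (Nat.prime_of_mem_primeFactors q.2) d l hs

/-! ## §4. `‖𝓜₁(1,1;1−βⱼ)‖ ≥ 1/2` for all large `D` under (A) (Lemma 15.2) -/

/-- The Euler product of Lemma 15.2 has modulus `≥ 1`: every factor
`(1 − χ(q)q⁻²)/(1 − q⁻²)` (`χ(q) = ±1`) or `1` has modulus `≥ 1` (`AppendixALocal.norm_main_bounds`),
and the product converges absolutely. [cite: Zhang2022LandauSiegel, §15 Lemma 15.2 p. 87] -/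
theorem one_le_norm_eulerM1 [NeZero D] (hquad : χ.IsQuadratic) :
    1 ≤ ‖Typed.Section15C.eulerM1 χ‖ := by
  classical
  set M : ℕ → ℂ := fun n => if Nat.Coprime n D then
      (1 - χ (n : ZMod D) * (n : ℂ)⁻¹ ^ 2) / (1 - (n : ℂ)⁻¹ ^ 2) else 1 with hM
  set g : Nat.Primes → ℂ := fun p => M p - 1 with hg
  have hF : (fun p : Nat.Primes => M p) = fun p => 1 + g p := by
    ext p; rw [hg]; ring
  have hg_le : ∀ p : Nat.Primes, ‖g p‖ ≤ 4 * (((p : ℕ) : ℝ) ^ 2)⁻¹ := by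
    intro p
    have hp := p.2
    have hq2 : (2 : ℝ) ≤ (p : ℕ) := by exact_mod_cast hp.two_le
    have h := AppendixALocal.norm_main_sub_one_le χ hp
    rw [hg]
    calc ‖M p - 1‖ ≤ 2 * ((((p : ℕ) : ℝ) - 1)⁻¹ - (((p : ℕ) : ℝ))⁻¹) := h
      _ ≤ 4 * (((p : ℕ) : ℝ) ^ 2)⁻¹ := by
          rw [inv_sub_inv (by linarith) (by linarith)]
          rw [show (((p:ℕ):ℝ) - (((p:ℕ):ℝ) - 1)) = 1 by ring]
          rw [div_eq_mul_inv, one_mul, ← one_div, ← one_div]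
          rw [mul_one_div, mul_one_div, div_le_div_iff₀ (by nlinarith) (by positivity)]
          nlinarith
  have hsum : Summable (fun p : Nat.Primes => 4 * (((p : ℕ) : ℝ) ^ 2)⁻¹) := by
    have h1 : Summable (fun n : ℕ => ((n : ℝ) ^ 2)⁻¹) := Real.summable_nat_pow_inv.mpr one_lt_two
    exact ((h1.comp_injective Nat.Primes.coe_nat_injective).mul_left 4)
  have hgs : Summable (fun p : Nat.Primes => ‖g p‖) := Summable.of_norm_bounded hsum
    (fun p => by rw [Real.norm_eq_abs, abs_of_nonneg (norm_nonneg _)]; exact hg_le p)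
  have hmult : Multipliable (fun p : Nat.Primes => M p) := by
    rw [hF]; exact multipliable_one_add_of_summable hgs
  have hprod : HasProd (fun p : Nat.Primes => M p) (Typed.Section15C.eulerM1 χ) := by
    have e : Typed.Section15C.eulerM1 χ = ∏' p : Nat.Primes, M p := by
      rw [AppendixALocal.eulerM1_eq_tprod]
      exact tprod_congr fun p => AppendixALocal.eulerFactor_eq_main χ p
    rw [e]; exact hmult.hasProd
  have hT : Tendsto (fun T : Finset Nat.Primes => ∏ p ∈ T, M p) atTop
      (𝓝 (Typed.Section15C.eulerM1 χ)) := hprod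
  -- every partial product has modulus `≥ 1`
  have hge : ∀ T : Finset Nat.Primes, 1 ≤ ‖∏ p ∈ T, M p‖ := by
    intro T
    rw [norm_prod]
    calc (1 : ℝ) = ∏ _p ∈ T, (1 : ℝ) := Finset.prod_const_one.symm
      _ ≤ ∏ p ∈ T, ‖M p‖ := Finset.prod_le_prod (fun _ _ => zero_le_one) fun p _ =>
          (AppendixALocal.norm_main_bounds χ hquad p.2).1
  have hclosed : IsClosed {z : ℂ | 1 ≤ ‖z‖} := isClosed_le continuous_const continuous_norm
  exact hclosed.mem_of_tendsto hT (Filter.Eventually.of_forall hge)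

/-- `α𝓛 → 0`: for every `ε > 0`, `α𝓛 ≤ ε` once `D ≥ ⌈exp(π/ε + 1)⌉ + 1` (`α𝓛 = π𝓛⁻⁸ ≤ π/𝓛`).
[cite: Zhang2022LandauSiegel, §2 (2.10)] -/
theorem alpha_mul_ell_le_of_le {ε : ℝ} (hε : 0 < ε) {D : ℕ}
    (hD : ⌈Real.exp (Real.pi / ε + 1)⌉₊ + 1 ≤ D) : Skeleton.alpha D * Skeleton.ell D ≤ ε := by
  have hℓ : Real.pi / ε + 1 ≤ Skeleton.ell D := AppendixALocal.le_ell_of_le hD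
  have hpos : 0 < Real.pi / ε := div_pos Real.pi_pos hε
  have hℓ1 : 1 ≤ Skeleton.ell D := by linarith
  have hℓ0 : Skeleton.ell D ≠ 0 := by linarith
  rw [Lemma83.alpha_mul_ell hℓ0]
  have h8 : Skeleton.ell D ≤ Skeleton.ell D ^ 8 := by
    calc Skeleton.ell D = Skeleton.ell D ^ 1 := (pow_one _).symm
      _ ≤ Skeleton.ell D ^ 8 := pow_le_pow_right₀ hℓ1 (by norm_num)
  calc Real.pi / Skeleton.ell D ^ 8 ≤ Real.pi / Skeleton.ell D :=
        div_le_div_of_nonneg_left Real.pi_pos.le (by linarith) h8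
    _ ≤ ε := by
        rw [div_le_iff₀ (by linarith)]
        have : Real.pi / ε * ε = Real.pi := div_mul_cancel₀ _ hε.ne'
        nlinarith

/-- `|βⱼ| < 5α` for all `j` once `15|c′|α𝓛 < 2` and `D ≥ 3` (`βⱼ = ibⱼ`,
`|bⱼ| ≤ 3α(1 + 5|c′|α𝓛)`, `Typed.AppendixB.betaJ_bound`). [cite: Zhang2022LandauSiegel, §2 (2.13)] -/
theorem norm_betaJ_lt (hD : 3 ≤ D) (hsmall : 15 * |c'| * (Skeleton.alpha D * Skeleton.ell D) < 2)
    (j : ℕ) : ‖Skeleton.betaJ c' D j‖ < 5 * Skeleton.alpha D := by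
  have hα : 0 < Skeleton.alpha D := Skeleton.alpha_pos hD
  have hℓ : 0 ≤ Skeleton.ell D := (Skeleton.one_lt_ell hD).le.trans' zero_le_one
  obtain ⟨b, hb, hbb⟩ := Typed.AppendixB.betaJ_bound c' D j hα.le hℓ
  rw [hb, norm_mul, Complex.norm_I, mul_one, Complex.norm_real, Real.norm_eq_abs]
  calc |b| ≤ 3 * Skeleton.alpha D * (1 + 5 * |c'| * Skeleton.alpha D * Skeleton.ell D) := hbb
    _ < 5 * Skeleton.alpha D := by nlinarith

/-- **`‖𝓜₁(1,1;1−βⱼ)‖ ≥ 1/2` for all large `D` under (A)**, `j` arbitrary: by Lemma 15.2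
(`AppendixALocal.lemma152I_holds`: `‖𝓜₁(1,1;s) − ∏_{(q,D)=1}(1−χ(q)q⁻²)/(1−q⁻²)‖ ≤ Cα𝓛` for
`|s − 1| < 5α`), `|βⱼ| < 5α`, the modulus `≥ 1` of that Euler product, and `Cα𝓛 ≤ 1/2` eventually.
[cite: Zhang2022LandauSiegel, §15 Lemma 15.2 p. 87] -/
theorem half_le_norm_calM1_one_one :
    Skeleton.ForAllLarge fun D _ χ => Skeleton.AssumptionA D χ →
      ∀ j : ℕ, 1 / 2 ≤ ‖calM1 c' χ 1 1 (1 - Skeleton.betaJ c' D j)‖ := by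
  obtain ⟨C, D₁, h152⟩ := AppendixALocal.lemma152I_holds c'
  -- thresholds: `D ≥ 3`, `C·α𝓛 ≤ 1/2`, `15|c′|α𝓛 < 2`
  set ε : ℝ := 1 / (2 * (max C 0 + 1) + 15 * |c'| + 1) with hε
  have hεpos : 0 < ε := by rw [hε]; positivity
  set D₂ : ℕ := ⌈Real.exp (Real.pi / ε + 1)⌉₊ + 1 with hD₂
  refine ⟨max (max D₁ D₂) 3, fun D _ χ hD hq hp hA j => ?_⟩
  have hD₁ : D₁ ≤ D := le_trans (le_trans (le_max_left _ _) (le_max_left _ _)) hD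
  have hD₂' : D₂ ≤ D := le_trans (le_trans (le_max_right _ _) (le_max_left _ _)) hD
  have hD3 : 3 ≤ D := le_trans (le_max_right _ _) hD
  have hαℓ : Skeleton.alpha D * Skeleton.ell D ≤ ε := alpha_mul_ell_le_of_le hεpos hD₂'
  have hαℓ0 : 0 ≤ Skeleton.alpha D * Skeleton.ell D :=
    mul_nonneg (Skeleton.alpha_pos hD3).le ((Skeleton.one_lt_ell hD3).le.trans' zero_le_one)
  have hK : 0 < 2 * (max C 0 + 1) + 15 * |c'| + 1 := by positivity
  have hεK : ε * (2 * (max C 0 + 1) + 15 * |c'| + 1) = 1 := by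
    rw [hε]; field_simp
  -- `15|c′|α𝓛 < 2`
  have hsmall : 15 * |c'| * (Skeleton.alpha D * Skeleton.ell D) < 2 := by
    have h1 : 15 * |c'| * (Skeleton.alpha D * Skeleton.ell D) ≤ 15 * |c'| * ε :=
      mul_le_mul_of_nonneg_left hαℓ (by positivity)
    have h2 : 15 * |c'| * ε ≤ 1 := by
      have : 0 ≤ (2 * (max C 0 + 1) + 1) * ε := by positivity
      nlinarith
    linarith
  -- `C·α𝓛 ≤ 1/2`
  have hCsmall : C * (Skeleton.alpha D * Skeleton.ell D) ≤ 1 / 2 := by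
    have h1 : C * (Skeleton.alpha D * Skeleton.ell D) ≤ (max C 0 + 1) * ε := by
      calc C * (Skeleton.alpha D * Skeleton.ell D)
          ≤ (max C 0 + 1) * (Skeleton.alpha D * Skeleton.ell D) :=
            mul_le_mul_of_nonneg_right (by linarith [le_max_left C 0]) hαℓ0
        _ ≤ (max C 0 + 1) * ε := mul_le_mul_of_nonneg_left hαℓ (by positivity)
    have h2 : (max C 0 + 1) * ε ≤ 1 / 2 := by
      have : 0 ≤ (15 * |c'| + 1) * ε := by positivity
      nlinarith
    linarith
  have hs : ‖(1 - Skeleton.betaJ c' D j) - 1‖ < 5 * Skeleton.alpha D := by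
    rw [sub_sub_cancel_left, norm_neg]; exact norm_betaJ_lt c' hD3 hsmall j
  have h := h152 D χ hD₁ hq hp hA (1 - Skeleton.betaJ c' D j) hs
  -- `h : ‖inputs15AB.calM1 c' χ 1 1 s − eulerM1 χ‖ ≤ C (α𝓛)`
  change ‖calM1 c' χ 1 1 (1 - Skeleton.betaJ c' D j) - Typed.Section15C.eulerM1 χ‖ ≤
    C * (Skeleton.alpha D * Skeleton.ell D) at h
  have h1 := one_le_norm_eulerM1 χ hq
  have htri := norm_sub_norm_le (Typed.Section15C.eulerM1 χ) (calM1 c' χ 1 1 (1 - Skeleton.betaJ c' D j))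
  rw [norm_sub_rev] at h
  linarith

/-! ## §5. (15.18) at `s = 1 − βⱼ` and the multiplicativity of `ϖ₁ⱼ` -/

/-- `Re(1 − βⱼ) = 1`. [cite: Zhang2022LandauSiegel, §2 (2.13)] -/
theorem one_sub_betaJ_re (D j : ℕ) : (1 - Skeleton.betaJ c' D j).re = 1 := by
  rw [Complex.sub_re, Complex.one_re, betaJ_re, sub_zero]

/-- **(15.18) at `s = 1 − βⱼ`** for all large `D` under (A), all `j`, all `d, l ≥ 1`: the Euler
product of `𝓜₁(1,1;1−βⱼ)` converges (§15.u034, `step15_u034an_holds`) to a value of modulus `≥ 1/2`,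
so `calM1_eq_calM1_mul_prod` applies; stated as the quotient identity of `Typed.Section15B.Eq15_18`
at this point, together with the lower bound. [cite: Zhang2022LandauSiegel, §15 (15.18) p. 85] -/
theorem eq15_18_at_betaJ :
    Skeleton.ForAllLarge fun D _ χ => Skeleton.AssumptionA D χ → ∀ j : ℕ,
      1 / 2 ≤ ‖calM1 c' χ 1 1 (1 - Skeleton.betaJ c' D j)‖ ∧
      (Multipliable fun p : Nat.Primes => calM1Factor c' χ (p : ℕ) 1 1 (1 - Skeleton.betaJ c' D j)) ∧
      ∀ d l : ℕ, 1 ≤ d → 1 ≤ l →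
        calM1 c' χ d l (1 - Skeleton.betaJ c' D j) / calM1 c' χ 1 1 (1 - Skeleton.betaJ c' D j) =
          ∏ q ∈ (d * l).primeFactors,
            (1 + lamTilde1 c' χ q d * xi1LocalSeries c' χ q d l (1 - Skeleton.betaJ c' D j)) *
              (1 + lamTilde1 c' χ q 1 * xi1LocalSeries c' χ q 1 1 (1 - Skeleton.betaJ c' D j))⁻¹ := by
  refine ((half_le_norm_calM1_one_one c').and (step15_u034an_holds c')).mono
    fun D _ χ _ _ h hA j => ?_
  obtain ⟨hhalf, h34⟩ := h
  have hlow := hhalf hA j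
  have hne : calM1 c' χ 1 1 (1 - Skeleton.betaJ c' D j) ≠ 0 := by
    intro h0; rw [h0, norm_zero] at hlow; linarith
  have hre : 9 / 10 < (1 - Skeleton.betaJ c' D j).re := by rw [one_sub_betaJ_re]; norm_num
  have hre0 : 0 < (1 - Skeleton.betaJ c' D j).re := by rw [one_sub_betaJ_re]; norm_num
  have hmul := (h34 hA 1 1 le_rfl le_rfl).1 _ hre
  refine ⟨hlow, hmul, fun d l hd hl => ?_⟩
  rw [calM1_eq_calM1_mul_prod c' χ hre0 hmul hne hd hl, mul_div_cancel_left₀ _ hne]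

/-- The divisor pairs of `mn`, `(m,n) = 1`, are the products of the divisor pairs of `m` and of `n`
(re-proved privately, as in `TypedSection15B`, to keep the import cone minimal). [folklore] -/
private theorem sum_divisorsAntidiagonal_mul_of_coprime {M : Type*} [AddCommMonoid M] {m n : ℕ}
    (hmn : m.Coprime n) (f : ℕ × ℕ → M) :
    ∑ w ∈ (m * n).divisorsAntidiagonal, f w =
      ∑ x ∈ m.divisorsAntidiagonal, ∑ y ∈ n.divisorsAntidiagonal, f (x.1 * y.1, x.2 * y.2) := by
  rw [← Finset.sum_product']
  symm
  apply Finset.sum_nbij fun ((i, j), k, l) ↦ (i * k, j * l)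
  · rintro ⟨⟨a1, a2⟩, ⟨b1, b2⟩⟩ h
    simp only [Nat.mem_divisorsAntidiagonal, Ne, Finset.mem_product] at h
    rcases h with ⟨⟨rfl, ha⟩, ⟨rfl, hb⟩⟩
    simp only [Nat.mem_divisorsAntidiagonal, mul_eq_zero, Ne]
    constructor
    · ring
    rw [mul_eq_zero] at *
    exact not_or_intro ha hb
  · simp only [Set.InjOn, Finset.mem_coe, Nat.mem_divisorsAntidiagonal, Finset.mem_product, Prod.mk_inj]
    rintro ⟨⟨a1, a2⟩, ⟨b1, b2⟩⟩ ⟨⟨rfl, ha⟩, ⟨rfl, hb⟩⟩ ⟨⟨c1, c2⟩, ⟨d1, d2⟩⟩ hcd h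
    have cop := hmn
    ext
    · trans Nat.gcd (a1 * a2) (a1 * b1)
      · rw [Nat.gcd_mul_left, cop.coprime_mul_left.coprime_mul_right_right.gcd_eq_one, mul_one]
      · rw [← hcd.1.1, ← hcd.2.1] at cop
        rw [← hcd.1.1, h.1, Nat.gcd_mul_left,
          cop.coprime_mul_left.coprime_mul_right_right.gcd_eq_one, mul_one]
    · trans Nat.gcd (a1 * a2) (a2 * b2)
      · rw [mul_comm, Nat.gcd_mul_left, cop.coprime_mul_right.coprime_mul_left_right.gcd_eq_one,
          mul_one]
      · rw [← hcd.1.1, ← hcd.2.1] at cop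
        rw [← hcd.1.1, h.2, mul_comm, Nat.gcd_mul_left,
          cop.coprime_mul_right.coprime_mul_left_right.gcd_eq_one, mul_one]
    · trans Nat.gcd (b1 * b2) (a1 * b1)
      · rw [mul_comm, Nat.gcd_mul_right,
          cop.coprime_mul_right.coprime_mul_left_right.symm.gcd_eq_one, one_mul]
      · rw [← hcd.1.1, ← hcd.2.1] at cop
        rw [← hcd.2.1, h.1, mul_comm c1 d1, Nat.gcd_mul_left,
          cop.coprime_mul_right.coprime_mul_left_right.symm.gcd_eq_one, mul_one]
    · trans Nat.gcd (b1 * b2) (a2 * b2)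
      · rw [Nat.gcd_mul_right, cop.coprime_mul_left.coprime_mul_right_right.symm.gcd_eq_one, one_mul]
      · rw [← hcd.1.1, ← hcd.2.1] at cop
        rw [← hcd.2.1, h.2, Nat.gcd_mul_right,
          cop.coprime_mul_left.coprime_mul_right_right.symm.gcd_eq_one, one_mul]
  · simp only [Set.SurjOn, Set.subset_def, Finset.mem_coe, Nat.mem_divisorsAntidiagonal,
      Finset.mem_product, Set.mem_image]
    rintro ⟨b1, b2⟩ h
    use ((b1.gcd m, b2.gcd m), (b1.gcd n, b2.gcd n))
    rw [← hmn.gcd_mul _, ← hmn.gcd_mul _, ← h.1, Nat.gcd_mul_gcd_of_coprime_of_mul_eq_mul hmn h.1,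
      Nat.gcd_mul_gcd_of_coprime_of_mul_eq_mul hmn.symm _]
    · rw [Ne, mul_eq_zero, not_or] at h
      simp [h.2.1, h.2.2]
    rw [mul_comm n m, h.1]
  · rintro ⟨⟨a1, a2⟩, ⟨b1, b2⟩⟩ _
    rfl

/-- **"In view of (15.18), we see that `ϖ₁ⱼ(n)` is a multiplicative function" HOLDS** (§15 p. 85,
tex L4246; `Typed.Section15B.Inline15_varpiMult c′`, for every `c′`; indeed for every `j`, not
only `1 ≤ j ≤ 3`): the tree's edge `inline15_varpiMult_of_eq15_18` re-run on the pointwise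
identity `eq15_18_at_betaJ` (the only instance of (15.18) that edge consumes).
[cite: Zhang2022LandauSiegel, §15 p. 85] -/
theorem inline15_varpiMult_holds : Inline15_varpiMult c' := by
  refine (eq15_18_at_betaJ c').mono fun D _ χ _ _ h hA j _ => ?_
  obtain ⟨hlow, -, hrat⟩ := h hA j
  have hM0 : calM1 c' χ 1 1 (1 - Skeleton.betaJ c' D j) ≠ 0 := by
    intro h0; rw [h0, norm_zero] at hlow; linarith
  constructor
  · unfold varpi1
    rw [Nat.divisorsAntidiagonal_one, Finset.sum_singleton, div_self hM0]
    unfold lam1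
    simp
  · intro m n hmn
    rcases Nat.eq_zero_or_pos m with hm0 | hm0
    · subst hm0
      simp [varpi1]
    rcases Nat.eq_zero_or_pos n with hn0 | hn0
    · subst hn0
      simp [varpi1]
    unfold varpi1
    rw [sum_divisorsAntidiagonal_mul_of_coprime hmn, Finset.sum_mul_sum]
    refine Finset.sum_congr rfl fun x hx => Finset.sum_congr rfl fun y hy => ?_
    have hx' := Nat.mem_divisorsAntidiagonal.mp hx
    have hy' := Nat.mem_divisorsAntidiagonal.mp hy
    have hx1 : 1 ≤ x.1 := Nat.pos_of_ne_zero fun h0 => hx'.2 (by rw [← hx'.1, h0, zero_mul])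
    have hx2 : 1 ≤ x.2 := Nat.pos_of_ne_zero fun h0 => hx'.2 (by rw [← hx'.1, h0, mul_zero])
    have hy1 : 1 ≤ y.1 := Nat.pos_of_ne_zero fun h0 => hy'.2 (by rw [← hy'.1, h0, zero_mul])
    have hy2 : 1 ≤ y.2 := Nat.pos_of_ne_zero fun h0 => hy'.2 (by rw [← hy'.1, h0, mul_zero])
    have hcop : Nat.Coprime (x.1 * x.2) (y.1 * y.2) := by rw [hx'.1, hy'.1]; exact hmn
    have hcop1 : Nat.Coprime x.1 y.1 :=
      Nat.Coprime.coprime_dvd_left (Dvd.intro _ rfl)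
        (Nat.Coprime.coprime_dvd_right (Dvd.intro _ rfl) hcop)
    simp only
    rw [div_eq_mul_inv, div_eq_mul_inv, div_eq_mul_inv]
    rw [← div_eq_mul_inv (calM1 c' χ (x.1 * y.1) (x.2 * y.2) _),
      ← div_eq_mul_inv (calM1 c' χ x.1 x.2 _), ← div_eq_mul_inv (calM1 c' χ y.1 y.2 _),
      hrat _ _ (Nat.one_le_iff_ne_zero.mpr (Nat.mul_ne_zero (by omega) (by omega)))
        (Nat.one_le_iff_ne_zero.mpr (Nat.mul_ne_zero (by omega) (by omega))),
      hrat x.1 x.2 hx1 hx2, hrat y.1 y.2 hy1 hy2, prod_localRatio_mul c' χ _ hcop,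
      lam1_mul_of_coprime c' χ hcop1]
    push_cast
    rw [Complex.natCast_mul_natCast_cpow, map_mul]
    ring

/-- `Inline15_varpiMult` — `_holds` alias of `inline15_varpiMult_holds` above under the fact's exact name (appended
2026-08-28, D-0026 bookkeeping: the proof term is the existing theorem of this file; no statement,
definition or attribute is edited; no new named fact; the ledger's debt table listed the fact
unproved). [cite: Zhang2022LandauSiegel, §15 p. 85] -/
theorem _root_.Literature.NumberTheory.LFunctions.Zhang2022.Typed.Section15B.Inline15_varpiMult_holds :
    Inline15_varpiMult c' :=
  _root_.Literature.NumberTheory.LFunctions.Zhang2022.Lemma153Rp.inline15_varpiMult_holds (c' := c')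

end Literature.NumberTheory.LFunctions.Zhang2022.Lemma153Rp

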